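import Mathlib

/-!
# ValiantsHypothesis / RigidityForcesSymmetry — crux `LaplaceOptimalFive` (stmt-ValiantsHypothesis-24813), crux idea
`young-shadow` (K1) ON THE STAR: **LEMMA 1 — a CLOSED RANK-ONE SHADOW IS FULLY SYMMETRIC** (letter currency)

The algebraic core of the `E = 0` reduction of K1 on the star (memo `pub/val-lit/lmr/NOTE-p4g15-24813-K1-star.md` §3 = star note
r3 §3 L1 / §9 F1 of val-idea-19 g7).  A rank-one Young shadow `Z(v) = U (v p) (v a) · W (v b) (v c) (v d)` (`U` a symmetric function
of two letters, `W` of three) whose star symmetrisation `Z + (a b)•Z + (a c)•Z + (a d)•Z` is fully slot-symmetric satisfies the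
letter identity

  `(C)  U a c·W b d e + U a d·W b c e + U a e·W b c d = U b c·W a d e + U b d·W a c e + U b e·W a c d`

(invariance of the symmetrisation under the slot transposition `(p a)`), and this file proves the purely algebraic statement

  `(C) ⟹ U a b·W c d e = U a c·W b d e`  (i.e. `U ⊗ W` is fully symmetric: `U = κ·μμᵀ`, `W = μ⊗μ⊗μ` up to scalars).

In the cubic-matrix currency this is «`(U y)·k` a gradient ⟹ `U = λλᵀ`, `k = c·ℓ³`», i.e. a closed rank-one element of
`Sym² ⊗ Sym³` is `Cat(c·ℓ⁵)` and carries no `S₍₃,₂₎`-slack.  Proof (elementary, no UFD): contract `(C)` against a vector `t` with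
`W(t,t,t) = ω ≠ 0` — four contractions give `ρ ω = κ μ`, `ω² U = κ(2ω ν − μμᵀ)`, `κ ω² W = κ(ω·Sym(μ⊗ν) − 2μ⊗μ⊗μ)` and finally
`Sym(n_a ⊗ n) = 0` for `n = ω ν − μμᵀ`, whence `n = 0`; the vector `t` exists as soon as `W ≠ 0` (a second finite difference of
`W(t,t,t)` along `t = e_a + s e_b + r e_c`).

Honest framing.  Pure algebra; the word-currency corollary (a star split carrying one term ⟹ weight `≥ 120`) is the sequel file.
K1 on the star in general, S2′, `LaplaceOptimalFive` (OPEN · CONTESTED 72/120), `RankRigidMinimalRepr`, `VP ≠ VNP` are NOT proved.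
No definitions, no `sorry`; Mathlib only.
-/

set_option linter.dupNamespace false

namespace Summit.ValiantsHypothesis.ValiantsHypothesis.Theorems.RigidityForcesSymmetryRankRigidMinimalRepr

namespace LaplaceFiveStar

open Finset

/-- Contraction against a combination of three coordinate vectors. [folklore] -/
theorem sum_three_point (a b c : Fin 5) (s r : ℂ) (g : Fin 5 → ℂ) :
    ∑ k : Fin 5, ((if k = a then (1 : ℂ) else 0) + s * (if k = b then 1 else 0) + r * (if k = c then 1 else 0)) * g k
      = g a + s * g b + r * g c := by
  simp only [add_mul, Finset.sum_add_distrib, ite_mul, one_mul, zero_mul, mul_assoc, ← Finset.mul_sum,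
    Finset.sum_ite_eq', Finset.mem_univ, if_true]

/-- **Existence of a non-isotropic vector for a non-zero symmetric ternary form** (second finite difference of the cubic
`t ↦ W(t,t,t)` along `t = e_a + s e_b + r e_c`). [folklore] -/
theorem exists_cube_ne (W : Fin 5 → Fin 5 → Fin 5 → ℂ)
    (hW1 : ∀ a b c, W a b c = W b a c) (hW2 : ∀ a b c, W a b c = W a c b)
    (h : ∀ t : Fin 5 → ℂ, ∑ d : Fin 5, t d * ∑ e : Fin 5, t e * ∑ b : Fin 5, t b * W b d e = 0) :
    ∀ a b c, W a b c = 0 := by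
  intro a b c
  -- the cubic along `e_a + s e_b + r e_c`
  have hp : ∀ s r : ℂ,
      let t : Fin 5 → ℂ := fun k => (if k = a then (1 : ℂ) else 0) + s * (if k = b then 1 else 0) + r * (if k = c then 1 else 0)
      ∑ d : Fin 5, t d * ∑ e : Fin 5, t e * ∑ b' : Fin 5, t b' * W b' d e
        = (W a a a + s * W b a a + r * W c a a) + s * (W a a b + s * W b a b + r * W c a b) + r * (W a a c + s * W b a c + r * W c a c)
          + s * ((W a b a + s * W b b a + r * W c b a) + s * (W a b b + s * W b b b + r * W c b b) + r * (W a b c + s * W b b c + r * W c b c))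
          + r * ((W a c a + s * W b c a + r * W c c a) + s * (W a c b + s * W b c b + r * W c c b) + r * (W a c c + s * W b c c + r * W c c c)) := by
    intro s r
    simp only [sum_three_point]
  have hv : ∀ s r : ℂ,
      (W a a a + s * W b a a + r * W c a a) + s * (W a a b + s * W b a b + r * W c a b) + r * (W a a c + s * W b a c + r * W c a c)
          + s * ((W a b a + s * W b b a + r * W c b a) + s * (W a b b + s * W b b b + r * W c b b) + r * (W a b c + s * W b b c + r * W c b c))
          + r * ((W a c a + s * W b c a + r * W c c a) + s * (W a c b + s * W b c b + r * W c c b) + r * (W a c c + s * W b c c + r * W c c c)) = 0 := by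
    intro s r
    rw [← hp s r]
    exact h _
  have h00 := hv 0 0
  have h10 := hv 1 0
  have h01 := hv 0 1
  have h11 := hv 1 1
  have h20 := hv 2 0
  have h02 := hv 0 2
  have h21 := hv 2 1
  have h12 := hv 1 2
  -- the six orderings of `(a, b, c)`
  have e1 : W b a c = W a b c := hW1 b a c ▸ rfl
  have e2 : W a c b = W a b c := (hW2 a b c).symm
  have e3 : W c a b = W a b c := by rw [hW1 c a b, hW2 a c b]
  have e4 : W b c a = W a b c := by rw [hW2 b c a, hW1 b a c]
  have e5 : W c b a = W a b c := by rw [hW1 c b a, hW2 b c a, hW1 b a c]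
  -- the mixed second difference isolates `12 · W a b c`
  have key : (12 : ℂ) * W a b c = 0 := by
    linear_combination 6 * h11 - 5 * h10 - 5 * h01 + 4 * h00 - h21 - h12 + h20 + h02
      - 2 * e1 - 2 * e2 - 2 * e3 - 2 * e4 - 2 * e5
  have h12ne : (12 : ℂ) ≠ 0 := by norm_num
  exact (mul_eq_zero.mp key).resolve_left h12ne

/-- **LEMMA 1 with a chosen non-isotropic vector.**  Under `(C)`, if `W(t,t,t) ≠ 0` then `U ⊗ W` is fully symmetric. [folklore] -/
theorem rankOne_closed_of_cube (U : Fin 5 → Fin 5 → ℂ) (W : Fin 5 → Fin 5 → Fin 5 → ℂ)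
    (hU : ∀ a b, U a b = U b a) (hW1 : ∀ a b c, W a b c = W b a c) (hW2 : ∀ a b c, W a b c = W a c b)
    (hC : ∀ a b c d e, U a c * W b d e + U a d * W b c e + U a e * W b c d
      = U b c * W a d e + U b d * W a c e + U b e * W a c d)
    (t : Fin 5 → ℂ) (hω : ∑ d : Fin 5, t d * ∑ e : Fin 5, t e * ∑ b : Fin 5, t b * W b d e ≠ 0) :
    ∀ a b c d e, U a b * W c d e = U a c * W b d e := by
  -- contracted quantities
  set ρ : Fin 5 → ℂ := fun C => ∑ B : Fin 5, t B * U B C with hρdef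
  set ν : Fin 5 → Fin 5 → ℂ := fun D E => ∑ B : Fin 5, t B * W B D E with hνdef
  set μ : Fin 5 → ℂ := fun D => ∑ E : Fin 5, t E * ν D E with hμdef
  set κ : ℂ := ∑ C : Fin 5, t C * ρ C with hκdef
  set ω : ℂ := ∑ D : Fin 5, t D * μ D with hωdef
  have hω' : ω ≠ 0 := hω
  -- symmetry bookkeeping
  have Wcyc : ∀ a d e, W a d e = W e a d := fun a d e => by rw [hW1 e a d, hW2 a e d]
  have hρ' : ∀ A, ∑ E : Fin 5, t E * U A E = ρ A := fun A =>
    Finset.sum_congr rfl fun E _ => by rw [hU A E]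
  have hν' : ∀ A D, ∑ E : Fin 5, t E * W A D E = ν A D := fun A D =>
    Finset.sum_congr rfl fun E _ => by rw [Wcyc A D E]
  have hνsymm : ∀ D E, ν D E = ν E D := fun D E =>
    Finset.sum_congr rfl fun B _ => by rw [hW2 B D E]
  -- (I7) : contract the second letter of (C) against t
  have I7 : ∀ A C D E, U A C * ν D E + U A D * ν C E + U A E * ν C D
      = ρ C * W A D E + ρ D * W A C E + ρ E * W A C D := by
    intro A C D E
    have hs : ∑ B : Fin 5, t B * (U A C * W B D E + U A D * W B C E + U A E * W B C D)
        = ∑ B : Fin 5, t B * (U B C * W A D E + U B D * W A C E + U B E * W A C D) :=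
      Finset.sum_congr rfl fun B _ => by rw [hC A B C D E]
    simp only [mul_add, Finset.sum_add_distrib] at hs
    have l1 : ∑ B : Fin 5, t B * (U A C * W B D E) = U A C * ν D E := by
      rw [hνdef]; simp only [Finset.mul_sum]; exact Finset.sum_congr rfl fun B _ => by ring
    have l2 : ∑ B : Fin 5, t B * (U A D * W B C E) = U A D * ν C E := by
      rw [hνdef]; simp only [Finset.mul_sum]; exact Finset.sum_congr rfl fun B _ => by ring
    have l3 : ∑ B : Fin 5, t B * (U A E * W B C D) = U A E * ν C D := by
      rw [hνdef]; simp only [Finset.mul_sum]; exact Finset.sum_congr rfl fun B _ => by ring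
    have r1 : ∑ B : Fin 5, t B * (U B C * W A D E) = ρ C * W A D E := by
      rw [hρdef]; simp only [Finset.sum_mul]; exact Finset.sum_congr rfl fun B _ => by ring
    have r2 : ∑ B : Fin 5, t B * (U B D * W A C E) = ρ D * W A C E := by
      rw [hρdef]; simp only [Finset.sum_mul]; exact Finset.sum_congr rfl fun B _ => by ring
    have r3 : ∑ B : Fin 5, t B * (U B E * W A C D) = ρ E * W A C D := by
      rw [hρdef]; simp only [Finset.sum_mul]; exact Finset.sum_congr rfl fun B _ => by ring
    rw [l1, l2, l3, r1, r2, r3] at hs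
    exact hs
  -- (I6) : contract the last letter of (I7) against t
  have I6 : ∀ A C D, U A C * μ D + U A D * μ C + ρ A * ν C D = ρ C * ν A D + ρ D * ν A C + κ * W A C D := by
    intro A C D
    have hs : ∑ E : Fin 5, t E * (U A C * ν D E + U A D * ν C E + U A E * ν C D)
        = ∑ E : Fin 5, t E * (ρ C * W A D E + ρ D * W A C E + ρ E * W A C D) :=
      Finset.sum_congr rfl fun E _ => by rw [I7 A C D E]
    simp only [mul_add, Finset.sum_add_distrib] at hs
    have l1 : ∑ E : Fin 5, t E * (U A C * ν D E) = U A C * μ D := by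
      rw [hμdef]; simp only [Finset.mul_sum]; exact Finset.sum_congr rfl fun E _ => by ring
    have l2 : ∑ E : Fin 5, t E * (U A D * ν C E) = U A D * μ C := by
      rw [hμdef]; simp only [Finset.mul_sum]; exact Finset.sum_congr rfl fun E _ => by ring
    have l3 : ∑ E : Fin 5, t E * (U A E * ν C D) = ρ A * ν C D := by
      rw [← hρ' A]; simp only [Finset.sum_mul]; exact Finset.sum_congr rfl fun E _ => by ring
    have r1 : ∑ E : Fin 5, t E * (ρ C * W A D E) = ρ C * ν A D := by
      rw [← hν' A D]; simp only [Finset.mul_sum]; exact Finset.sum_congr rfl fun E _ => by ring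
    have r2 : ∑ E : Fin 5, t E * (ρ D * W A C E) = ρ D * ν A C := by
      rw [← hν' A C]; simp only [Finset.mul_sum]; exact Finset.sum_congr rfl fun E _ => by ring
    have r3 : ∑ E : Fin 5, t E * (ρ E * W A C D) = κ * W A C D := by
      rw [hκdef]; simp only [Finset.sum_mul]; exact Finset.sum_congr rfl fun E _ => by ring
    rw [l1, l2, l3, r1, r2, r3] at hs
    exact hs
  -- (I4) : contract the last letter of (I6) against t
  have I4 : ∀ A C, U A C * ω + ρ A * μ C + ρ A * μ C = ρ C * μ A + κ * ν A C + κ * ν A C := by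
    intro A C
    have hs : ∑ D : Fin 5, t D * (U A C * μ D + U A D * μ C + ρ A * ν C D)
        = ∑ D : Fin 5, t D * (ρ C * ν A D + ρ D * ν A C + κ * W A C D) :=
      Finset.sum_congr rfl fun D _ => by rw [I6 A C D]
    simp only [mul_add, Finset.sum_add_distrib] at hs
    have l1 : ∑ D : Fin 5, t D * (U A C * μ D) = U A C * ω := by
      rw [hωdef]; simp only [Finset.mul_sum]; exact Finset.sum_congr rfl fun D _ => by ring
    have l2 : ∑ D : Fin 5, t D * (U A D * μ C) = ρ A * μ C := by
      rw [← hρ' A]; simp only [Finset.sum_mul]; exact Finset.sum_congr rfl fun D _ => by ring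
    have l3 : ∑ D : Fin 5, t D * (ρ A * ν C D) = ρ A * μ C := by
      rw [hμdef]; simp only [Finset.mul_sum]; exact Finset.sum_congr rfl fun D _ => by ring
    have r1 : ∑ D : Fin 5, t D * (ρ C * ν A D) = ρ C * μ A := by
      rw [hμdef]; simp only [Finset.mul_sum]; exact Finset.sum_congr rfl fun D _ => by ring
    have r2 : ∑ D : Fin 5, t D * (ρ D * ν A C) = κ * ν A C := by
      rw [hκdef]; simp only [Finset.sum_mul]; exact Finset.sum_congr rfl fun D _ => by ring
    have r3 : ∑ D : Fin 5, t D * (κ * W A C D) = κ * ν A C := by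
      rw [← hν' A C]; simp only [Finset.mul_sum]; exact Finset.sum_congr rfl fun D _ => by ring
    rw [l1, l2, l3, r1, r2, r3] at hs
    exact hs
  -- (I2) : contract the last letter of (I4) against t
  have I2 : ∀ A, ρ A * ω = κ * μ A := by
    intro A
    have hs : ∑ C : Fin 5, t C * (U A C * ω + ρ A * μ C + ρ A * μ C)
        = ∑ C : Fin 5, t C * (ρ C * μ A + κ * ν A C + κ * ν A C) :=
      Finset.sum_congr rfl fun C _ => by rw [I4 A C]
    simp only [mul_add, Finset.sum_add_distrib] at hs
    have l1 : ∑ C : Fin 5, t C * (U A C * ω) = ρ A * ω := by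
      rw [← hρ' A]; simp only [Finset.sum_mul]; exact Finset.sum_congr rfl fun C _ => by ring
    have l2 : ∑ C : Fin 5, t C * (ρ A * μ C) = ρ A * ω := by
      rw [hωdef]; simp only [Finset.mul_sum]; exact Finset.sum_congr rfl fun C _ => by ring
    have r1 : ∑ C : Fin 5, t C * (ρ C * μ A) = κ * μ A := by
      rw [hκdef]; simp only [Finset.sum_mul]; exact Finset.sum_congr rfl fun C _ => by ring
    have r2 : ∑ C : Fin 5, t C * (κ * ν A C) = κ * μ A := by
      rw [hμdef]; simp only [Finset.mul_sum]; exact Finset.sum_congr rfl fun C _ => by ring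
    rw [l1, l2, r1, r2] at hs
    linear_combination hs / 3
  intro a b c d e
  by_cases hκ : κ = 0
  · -- κ = 0 : then ρ = 0 and U = 0
    have hρ0 : ∀ A, ρ A = 0 := fun A => by
      have h := I2 A
      rw [hκ, zero_mul] at h
      exact (mul_eq_zero.mp h).resolve_right hω'
    have hU0 : ∀ A C, U A C = 0 := fun A C => by
      have h := I4 A C
      rw [hρ0 A, hρ0 C, hκ] at h
      have h' : U A C * ω = 0 := by linear_combination h
      exact (mul_eq_zero.mp h').resolve_right hω'
    rw [hU0 a b, hU0 a c, zero_mul, zero_mul]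
  -- κ ≠ 0 : the rank-one structure
  have hUe : ∀ A C, U A C * ω ^ 2 = κ * (2 * ω * ν A C - μ A * μ C) := fun A C => by
    linear_combination ω * I4 A C + μ A * I2 C - 2 * μ C * I2 A
  have hWe : ∀ A C D, κ * (W A C D * ω ^ 2)
      = κ * (ω * (ν A C * μ D + ν A D * μ C + μ A * ν C D) - 2 * (μ A * μ C * μ D)) := fun A C D => by
    linear_combination (-ω ^ 2) * I6 A C D + μ D * hUe A C + μ C * hUe A D + ω * ν C D * I2 A
      - ω * ν A D * I2 C - ω * ν A C * I2 D
  -- the deviation `n = ω ν − μ μᵀ` has vanishing symmetrised square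
  have hS : ∀ A C D E,
      (ω * ν A C - μ A * μ C) * (ω * ν D E - μ D * μ E) + (ω * ν A D - μ A * μ D) * (ω * ν C E - μ C * μ E)
        + (ω * ν A E - μ A * μ E) * (ω * ν C D - μ C * μ D) = 0 := by
    intro A C D E
    have key : κ ^ 2 * (2 * ((ω * ν A C - μ A * μ C) * (ω * ν D E - μ D * μ E)
        + (ω * ν A D - μ A * μ D) * (ω * ν C E - μ C * μ E) + (ω * ν A E - μ A * μ E) * (ω * ν C D - μ C * μ D))) = 0 := by
      linear_combination (κ * ω ^ 3) * I7 A C D E - (κ * ω * ν D E) * hUe A C - (κ * ω * ν C E) * hUe A D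
        - (κ * ω * ν C D) * hUe A E + (κ * W A D E * ω ^ 2) * I2 C + (κ * μ C) * hWe A D E
        + (κ * W A C E * ω ^ 2) * I2 D + (κ * μ D) * hWe A C E + (κ * W A C D * ω ^ 2) * I2 E + (κ * μ E) * hWe A C D
    have h2 : (κ ^ 2 * 2 : ℂ) ≠ 0 := mul_ne_zero (pow_ne_zero 2 hκ) two_ne_zero
    have := mul_eq_zero.mp (by rw [← mul_assoc] at key; exact key)
    exact this.resolve_left h2
  have hnAA : ∀ A, ω * ν A A - μ A * μ A = 0 := fun A => by
    have h := hS A A A A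
    have h3 : 3 * ((ω * ν A A - μ A * μ A) * (ω * ν A A - μ A * μ A)) = 0 := by linear_combination h
    exact mul_self_eq_zero.mp ((mul_eq_zero.mp h3).resolve_left three_ne_zero)
  have hn : ∀ A C, ω * ν A C = μ A * μ C := fun A C => by
    have h := hS A C C A
    rw [hνsymm C A, hnAA A, hnAA C] at h
    have h2 : 2 * ((ω * ν A C - μ A * μ C) * (ω * ν A C - μ A * μ C)) = 0 := by linear_combination h
    have := mul_self_eq_zero.mp ((mul_eq_zero.mp h2).resolve_left two_ne_zero)
    linear_combination this
  have hU2 : ∀ A C, U A C * ω ^ 2 = κ * (μ A * μ C) := fun A C => by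
    linear_combination hUe A C + 2 * κ * hn A C
  have hW2 : ∀ A C D, W A C D * ω ^ 2 = μ A * μ C * μ D := fun A C D => by
    have h : κ * (W A C D * ω ^ 2) = κ * (μ A * μ C * μ D) := by
      linear_combination hWe A C D + κ * μ D * hn A C + κ * μ C * hn A D + κ * μ A * hn C D
    exact mul_left_cancel₀ hκ h
  have hfin : (U a b * W c d e - U a c * W b d e) * ω ^ 4 = 0 := by
    linear_combination (W c d e * ω ^ 2) * hU2 a b + κ * (μ a * μ b) * hW2 c d e
      - (W b d e * ω ^ 2) * hU2 a c - κ * (μ a * μ c) * hW2 b d e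
  have := (mul_eq_zero.mp hfin).resolve_right (pow_ne_zero 4 hω')
  linear_combination this

/-- **LEMMA 1 (closed rank one ⟹ fully symmetric), letter currency.**  For a symmetric `U : Fin 5 → Fin 5 → ℂ` and a symmetric
`W : Fin 5 → Fin 5 → Fin 5 → ℂ`, the exchange identity `(C)` forces `U a b·W c d e` to be a symmetric function of all five letters. [folklore] -/
theorem rankOne_closed (U : Fin 5 → Fin 5 → ℂ) (W : Fin 5 → Fin 5 → Fin 5 → ℂ)
    (hU : ∀ a b, U a b = U b a) (hW1 : ∀ a b c, W a b c = W b a c) (hW2 : ∀ a b c, W a b c = W a c b)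
    (hC : ∀ a b c d e, U a c * W b d e + U a d * W b c e + U a e * W b c d
      = U b c * W a d e + U b d * W a c e + U b e * W a c d) :
    ∀ a b c d e, U a b * W c d e = U a c * W b d e := by
  by_cases h : ∀ t : Fin 5 → ℂ, ∑ d : Fin 5, t d * ∑ e : Fin 5, t e * ∑ b : Fin 5, t b * W b d e = 0
  · have hW0 := exists_cube_ne W hW1 hW2 h
    intro a b c d e
    rw [hW0 c d e, hW0 b d e, mul_zero, mul_zero]
  · push Not at h
    obtain ⟨t, ht⟩ := h
    exact rankOne_closed_of_cube U W hU hW1 hW2 hC t ht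

end LaplaceFiveStar

end Summit.ValiantsHypothesis.ValiantsHypothesis.Theorems.RigidityForcesSymmetryRankRigidMinimalRepr
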